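import Mathlib
import Summits.ValiantsHypothesis.ValiantsHypothesis.Theorems.BarrierLeverPartitionMinorsHitByVPHiddenStatesSecondShellAnyHCells
import Summits.ValiantsHypothesis.ValiantsHypothesis.Theorems.BarrierLeverPartitionMinorsHitByVPHiddenStatesTwoUnfed

/-!
# Route BarrierLever — item `PartitionMinorsHitByVP` (stmt-ValiantsHypothesis-19717), line `hidden-states`:
# ★★ SECOND-SHELL «TWO TOPS» CLASSES OF EVERY BALL — the entangled classes, by THEOREM 2U

Helper file (`--supports stmt-ValiantsHypothesis-19717`; cell valiant-natproofs, 𝒟-side door (c), registered line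
`Cruxes/PartitionMinorsHitByVP/Lines/hidden_states.lean` v8; prover seat val-np-p6 gen 17).  Closes NO item; definition-free.

THE CELL (memo HOME/val-np-p6/g17/MEMO-valnp6-g17.md §4).  `U = B_t(h) ∖ {A₁,A₂} ∪ {C₁,C₂}` (`|A_l| = t`, `|C_l| = t+1`, `A_l ⊄ C_l`,
`A₁ ≠ A₂`, `C₁ ≠ C₂`) with TWO-TOPS data: `y ∈ (C₁∖A₁) ∖ (A₂ ∪ C₂)`, `y' ∈ (C₂∖A₂) ∩ A₁ ∩ C₁`, and path predecessors `p ∈ (C₁∖A₁)∖{y}`,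
`p' ∈ (C₂∖A₂)∖{y'}` with `p ≠ p'` (TABLE-FREE conditions).  Orient path 1 with top `y` and second `p`, path 2 with top `y'` and second `p'`
(`exists_equiv_four_tops`): then `y, y'` are tokens of `C₁` outside `A₂` that are NOBODY'S SOURCE in the two-parameter table and whose source
sets `{p}`, `{p'}` are disjoint, so THEOREM 2U (`…TwoUnfed.det_eq_zero_of_two_unfed`) kills the cross minor `D_{B − A₂ + C₁}` for every
parameter, and `…SecondShellExchange` composes the two first-shell certificates.  ★★ `exists_table_secondShell_twoTops`.
With the immobile-token cell (`…SecondShellAnyHCells`) this serves ALL 390 second-shell families of `B₂(5)` and 210 525 / 214 515 at `t = 3`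
(lab/twotops.py).

HONEST LABEL: conjecture-column cells (second shell, every `t, h`); 19717 stays OPEN; nothing on crux 14610 or VP ≠ VNP.
-/

set_option linter.dupNamespace false

namespace Summit.ValiantsHypothesis.ValiantsHypothesis.Theorems.BarrierLever.HiddenStates

open Finset

noncomputable section

namespace SecondShell

open PathTable

variable {α : Type} [Fintype α] [DecidableEq α]

/-! ## Transport with a prescribed top and second element of the path -/

/-- a four-part transport whose Y-path has prescribed TOP `y = e(inl (inl (last k)))` and SECOND element `p = e(inl (inl (k−1)))`. -/
theorem exists_equiv_four_tops (A C : Finset α) {k j j' : ℕ} (hk : 1 ≤ k)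
    (h1 : (C \ A).card = k + 1) (h2 : (A \ C).card = k) (h3 : (A ∩ C).card = j) (h4 : (A ∪ C)ᶜ.card = j')
    {y p : α} (hy : y ∈ C \ A) (hp : p ∈ C \ A) (hyp : y ≠ p) :
    ∃ e : (Fin (k + 1) ⊕ Fin k) ⊕ (Fin j ⊕ Fin j') ≃ α,
      (∀ b, e (Sum.inl (Sum.inl b)) ∈ C \ A) ∧ (∀ i, e (Sum.inl (Sum.inr i)) ∈ A \ C) ∧
      (∀ z, e (Sum.inr (Sum.inl z)) ∈ A ∩ C) ∧ (∀ w, e (Sum.inr (Sum.inr w)) ∈ (A ∪ C)ᶜ) ∧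
      e (Sum.inl (Sum.inl (Fin.last k))) = y ∧ e (Sum.inl (Sum.inl ⟨k - 1, by omega⟩)) = p := by
  classical
  obtain ⟨e, m1, m2, m3, m4⟩ := exists_equiv_four' A C h1 h2 h3 h4
  -- preimages of `y` and `p` lie in the Y-block
  have hYblock : ∀ x : α, x ∈ C \ A → ∃ b, e.symm x = Sum.inl (Sum.inl b) := by
    intro x hx
    rcases hex : e.symm x with (b | i) | (z | w')
    · exact ⟨b, rfl⟩
    · exfalso; have := m2 i; rw [← hex, Equiv.apply_symm_apply] at this
      rw [Finset.mem_sdiff] at hx this; exact this.2 hx.1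
    · exfalso; have := m3 z; rw [← hex, Equiv.apply_symm_apply] at this
      rw [Finset.mem_sdiff] at hx; rw [Finset.mem_inter] at this; exact hx.2 this.1
    · exfalso; have := m4 w'; rw [← hex, Equiv.apply_symm_apply] at this
      rw [Finset.mem_sdiff] at hx; rw [Finset.mem_compl, Finset.mem_union] at this; exact this (Or.inr hx.1)
  obtain ⟨iy, hiy⟩ := hYblock y hy
  obtain ⟨ip, hip⟩ := hYblock p hp
  have hiyp : iy ≠ ip := by
    intro h; apply hyp
    have := hiy; rw [h, ← hip] at this; exact e.symm.injective this
  set last : Fin (k + 1) := Fin.last k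
  set km1 : Fin (k + 1) := ⟨k - 1, by omega⟩
  have hlk : last ≠ km1 := by intro h; have := congrArg Fin.val h; simp [last, km1] at this; omega
  let τ₁ : Equiv.Perm (Fin (k + 1)) := Equiv.swap last iy
  let τ₂ : Equiv.Perm (Fin (k + 1)) := Equiv.swap km1 (τ₁ ip)
  let σ : Equiv.Perm (Fin (k + 1)) := τ₂.trans τ₁
  have hσlast : σ last = iy := by
    have hne' : τ₁ ip ≠ last := by
      intro h
      have : ip = iy := by
        have h' := congrArg τ₁ h
        simp only [τ₁, Equiv.swap_apply_self, Equiv.swap_apply_left] at h'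
        exact h'
      exact hiyp this.symm
    show τ₁ (τ₂ last) = iy
    rw [show τ₂ last = last from Equiv.swap_apply_of_ne_of_ne hlk (Ne.symm hne')]
    exact Equiv.swap_apply_left _ _
  have hσkm1 : σ km1 = ip := by
    show τ₁ (τ₂ km1) = ip
    rw [show τ₂ km1 = τ₁ ip from Equiv.swap_apply_left _ _]
    exact Equiv.swap_apply_self _ _ _
  let e' : (Fin (k + 1) ⊕ Fin k) ⊕ (Fin j ⊕ Fin j') ≃ α :=
    (Equiv.sumCongr (Equiv.sumCongr σ (Equiv.refl (Fin k))) (Equiv.refl (Fin j ⊕ Fin j'))).trans e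
  have he' : ∀ x, e' x = e (Sum.map (Sum.map σ id) id x) := fun x => rfl
  refine ⟨e', fun b => ?_, fun i => ?_, fun z => ?_, fun w' => ?_, ?_, ?_⟩
  · rw [he']; exact m1 (σ b)
  · rw [he']; exact m2 i
  · rw [he']; exact m3 z
  · rw [he']; exact m4 w'
  · rw [he']; show e (Sum.inl (Sum.inl (σ last))) = y
    rw [hσlast, ← hiy, Equiv.apply_symm_apply]
  · rw [he']; show e (Sum.inl (Sum.inl (σ km1))) = p
    rw [hσkm1, ← hip, Equiv.apply_symm_apply]

/-! ## Table facts for a transported swap table -/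

omit [Fintype α] [DecidableEq α] in
/-- diagonal entries are `1`. -/
theorem swapTable'_self {k j j' : ℕ} (e : (Fin (k + 1) ⊕ Fin k) ⊕ (Fin j ⊕ Fin j') ≃ α) (a : α) : swapTable' e a a = 1 := by
  unfold swapTable'
  rcases e.symm a with (b | i) | z
  · simp [coreTable', pw]
  · rw [coreTable'_inr_row, if_pos rfl]
  · simp [coreTable']

omit [Fintype α] in
/-- **unit columns**: a coordinate that is neither an X-element nor a non-top Y-element is nobody's source. -/
theorem swapTable'_col_unit {k j j' : ℕ} (A C : Finset α) (e : (Fin (k + 1) ⊕ Fin k) ⊕ (Fin j ⊕ Fin j') ≃ α)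
    (m1 : ∀ b, e (Sum.inl (Sum.inl b)) ∈ C \ A) (m2 : ∀ i, e (Sum.inl (Sum.inr i)) ∈ A \ C)
    {d : α} (hd1 : d ∉ A \ C) (hd2 : d ∈ C \ A → d = e (Sum.inl (Sum.inl (Fin.last k))))
    {a : α} (had : a ≠ d) : swapTable' e a d = 0 := by
  unfold swapTable'
  have hne : e.symm a ≠ e.symm d := fun h => had (e.symm.injective h)
  rcases hx : e.symm d with (b | i) | z
  · -- `d` is a Y-element, hence the top
    have hdY : d ∈ C \ A := by have := m1 b; rwa [← hx, Equiv.apply_symm_apply] at this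
    have hb : b = Fin.last k := by
      have := hd2 hdY; rw [← Equiv.apply_symm_apply e d, hx] at this
      have h' := e.injective this; simpa using h'
    rcases ha : e.symm a with (a' | i') | z'
    · simp only [coreTable', pw]
      rw [if_neg, if_neg]
      · intro h; subst hb; have := a'.isLt; simp [Fin.val_last] at h; omega
      · intro h; apply hne; rw [ha, hx, h]
    · rw [coreTable'_inr_row, if_neg]; simp
    · simp [coreTable']
  · exfalso; apply hd1; have := m2 i; rwa [← hx, Equiv.apply_symm_apply] at this
  · rcases ha : e.symm a with (a' | i') | z'
    · simp [coreTable']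
    · rw [coreTable'_inr_row, if_neg]; simp
    · have : coreTable' k j j' (Sum.inr z') (Sum.inr z) = if (Sum.inr z : (Fin (k + 1) ⊕ Fin k) ⊕ (Fin j ⊕ Fin j')) = Sum.inr z'
          then 1 else 0 := by simp [coreTable']
      rw [this, if_neg]; intro h; apply hne; rw [ha, hx, h]

omit [Fintype α] [DecidableEq α] in
/-- **the top row**: the sources of the top `y = e(inl (inl last))` are only its predecessor `p = e(inl (inl (k−1)))`. -/
theorem swapTable'_top_row {k j j' : ℕ} (hk : 1 ≤ k) (e : (Fin (k + 1) ⊕ Fin k) ⊕ (Fin j ⊕ Fin j') ≃ α) {d : α}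
    (hd : swapTable' e (e (Sum.inl (Sum.inl (Fin.last k)))) d ≠ 0) (hne : d ≠ e (Sum.inl (Sum.inl (Fin.last k)))) :
    d = e (Sum.inl (Sum.inl ⟨k - 1, by omega⟩)) := by
  unfold swapTable' at hd
  rw [Equiv.symm_apply_apply] at hd
  have hne' : e.symm d ≠ Sum.inl (Sum.inl (Fin.last k)) := by
    intro h; apply hne; rw [← h, Equiv.apply_symm_apply]
  rcases hx : e.symm d with (b | i) | z
  · rw [hx] at hd hne'
    simp only [coreTable', pw] at hd
    by_cases h1 : b = Fin.last k
    · exact (hne' (by rw [h1])).elim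
    · rw [if_neg h1] at hd
      by_cases h2 : (b : ℕ) + 1 = (Fin.last k : ℕ)
      · have hb : b = ⟨k - 1, by omega⟩ := by ext; simp [Fin.val_last] at h2; simp; omega
        rw [← hb, ← hx, Equiv.apply_symm_apply]
      · rw [if_neg h2] at hd; exact (hd rfl).elim
  · rw [hx] at hd
    simp only [coreTable', pw] at hd
    rw [if_neg] at hd
    · exact (hd rfl).elim
    · simp only [lvlX, Fin.val_last]; have := i.isLt; omega
  · rw [hx] at hd; simp [coreTable'] at hd

/-! ## ★★ The cell -/

/-- ★★ **SECOND SHELL, TWO-TOPS CLASSES, EVERY `t, h`.** -/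
theorem exists_table_secondShell_twoTops (h t : ℕ) (A₁ A₂ C₁ C₂ : Finset (Fin h))
    (hA₁ : A₁.card = t) (hA₂ : A₂.card = t) (hC₁ : C₁.card = t + 1) (hC₂ : C₂.card = t + 1)
    (h₁ : ¬ A₁ ⊆ C₁) (h₂ : ¬ A₂ ⊆ C₂) (hA : A₁ ≠ A₂) (hC : C₁ ≠ C₂)
    {y p y' p' : Fin h} (hy₁ : y ∈ C₁) (hy₂ : y ∉ A₁) (hy₃ : y ∉ A₂) (hy₄ : y ∉ C₂) (hp₁ : p ∈ C₁) (hp₂ : p ∉ A₁) (hpy : p ≠ y)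
    (hy'₁ : y' ∈ C₂) (hy'₂ : y' ∉ A₂) (hy'₃ : y' ∈ A₁) (hy'₄ : y' ∈ C₁) (hp'₁ : p' ∈ C₂) (hp'₂ : p' ∉ A₂) (hp'y : p' ≠ y')
    (hpp : p ≠ p')
    {r : ℕ} (u cols : Fin r → Finset (Fin h)) (hu : Function.Injective u)
    (hU : ∀ i, ((u i).card ≤ t ∧ u i ≠ A₁ ∧ u i ≠ A₂) ∨ u i = C₁ ∨ u i = C₂)
    (hcols : ∀ J : Finset (Fin h), J.card ≤ t → ∃ kk, cols kk = J) :
    ∃ tx : Option (Fin h) → Fin h → ℂ,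
      (Matrix.of fun i kk : Fin r => ∏ a ∈ u i, (tx none a + ∑ q ∈ cols kk, tx (some q) a)).det ≠ 0 := by
  classical
  obtain ⟨k₁, j₁, j₁', hk₁, hkj₁, a1, a2, a3, a4⟩ := swap_sizes A₁ C₁ hA₁ hC₁ h₁
  obtain ⟨k₂, j₂, j₂', hk₂, hkj₂, b1, b2, b3, b4⟩ := swap_sizes A₂ C₂ hA₂ hC₂ h₂
  obtain ⟨e₁, m1, m2, m3, m4, htop₁, hpred₁⟩ := exists_equiv_four_tops A₁ C₁ hk₁ a1 a2 a3 a4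
    (Finset.mem_sdiff.2 ⟨hy₁, hy₂⟩) (Finset.mem_sdiff.2 ⟨hp₁, hp₂⟩) (Ne.symm hpy)
  obtain ⟨e₂, n1, n2, n3, n4, htop₂, hpred₂⟩ := exists_equiv_four_tops A₂ C₂ hk₂ b1 b2 b3 b4
    (Finset.mem_sdiff.2 ⟨hy'₁, hy'₂⟩) (Finset.mem_sdiff.2 ⟨hp'₁, hp'₂⟩) (Ne.symm hp'y)
  let N₁ : Fin h → Fin h → ℂ := fun a q => swapTable' e₁ a q - if q = a then 1 else 0
  let N₂ : Fin h → Fin h → ℂ := fun a q => swapTable' e₂ a q - if q = a then 1 else 0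
  have hT10 : tab2 N₁ N₂ ![1, 0] = swapTable' e₁ := by funext a q; simp [tab2, N₁]
  have hT01 : tab2 N₁ N₂ ![0, 1] = swapTable' e₂ := by funext a q; simp [tab2, N₂]
  -- bookkeeping (verbatim from the immobile-token cell)
  set Ball := Finset.univ.filter fun S : Finset (Fin h) => S.card ≤ t with hBall
  set 𝒰 := insert C₁ (insert C₂ ((Ball.erase A₁).erase A₂)) with h𝒰
  have hBA₁ : A₁ ∈ Ball := Finset.mem_filter.2 ⟨Finset.mem_univ _, by omega⟩
  have hBA₂ : A₂ ∈ Ball := Finset.mem_filter.2 ⟨Finset.mem_univ _, by omega⟩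
  have hBC₁ : C₁ ∉ Ball := fun h' => by have := (Finset.mem_filter.1 h').2; omega
  have hBC₂ : C₂ ∉ Ball := fun h' => by have := (Finset.mem_filter.1 h').2; omega
  have h𝒰card : 𝒰.card = Ball.card := card_secondShell_rows Ball hBA₁ hBA₂ hBC₁ hBC₂ hA hC
  have hUmem : ∀ i, u i ∈ 𝒰 := by
    intro i
    rcases hU i with ⟨hc, hne₁, hne₂⟩ | h' | h'
    · refine Finset.mem_insert_of_mem (Finset.mem_insert_of_mem ?_)
      exact Finset.mem_erase.2 ⟨hne₂, Finset.mem_erase.2 ⟨hne₁, Finset.mem_filter.2 ⟨Finset.mem_univ _, hc⟩⟩⟩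
    · rw [h']; exact Finset.mem_insert_self _ _
    · rw [h']; exact Finset.mem_insert_of_mem (Finset.mem_insert_self _ _)
  obtain ⟨hhit, hcolcard⟩ := rows_cover t 𝒰 h𝒰card u cols hu hUmem hcols
  obtain ⟨i₁, hi₁⟩ := hhit C₁ (Finset.mem_insert_self _ _)
  obtain ⟨i₂, hi₂⟩ := hhit C₂ (Finset.mem_insert_of_mem (Finset.mem_insert_self _ _))
  have hne : i₁ ≠ i₂ := fun h' => hC (by rw [← hi₁, ← hi₂, h'])
  have hball : ∀ R : Finset (Fin h), R.card ≤ t → R ≠ A₁ → R ≠ A₂ → ∃ i, i ≠ i₁ ∧ i ≠ i₂ ∧ u i = R := by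
    intro R hR hR₁ hR₂
    obtain ⟨i, hi⟩ := hhit R (Finset.mem_insert_of_mem (Finset.mem_insert_of_mem
      (Finset.mem_erase.2 ⟨hR₂, Finset.mem_erase.2 ⟨hR₁, Finset.mem_filter.2 ⟨Finset.mem_univ _, hR⟩⟩⟩)))
    refine ⟨i, ?_, ?_, hi⟩ <;> (rintro rfl; first | (rw [hi₁] at hi) | (rw [hi₂] at hi)) <;> (rw [← hi] at hR; omega)
  let b : Fin r → Finset (Fin h) := Function.update (Function.update u i₁ A₁) i₂ A₂
  have hb₁ : b i₁ = A₁ := by simp only [b, Function.update_of_ne hne, Function.update_self]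
  have hb₂ : b i₂ = A₂ := by simp only [b, Function.update_self]
  have hb : ∀ i, i ≠ i₁ → i ≠ i₂ → b i = u i := fun i h1 h2 => by simp only [b, Function.update_of_ne h2, Function.update_of_ne h1]
  have hub : Function.update (Function.update b i₁ C₁) i₂ C₂ = u := by
    funext i
    by_cases h2 : i = i₂
    · subst h2; rw [Function.update_self, hi₂]
    · rw [Function.update_of_ne h2]
      by_cases h1 : i = i₁
      · subst h1; rw [Function.update_self, hi₁]
      · rw [Function.update_of_ne h1, hb i h1 h2]
  have hbval : ∀ i, i ≠ i₁ → i ≠ i₂ → (b i).card ≤ t ∧ b i ≠ A₁ ∧ b i ≠ A₂ := by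
    intro i h1 h2
    rw [hb i h1 h2]
    rcases hU i with h' | h' | h'
    · exact h'
    · exact absurd (hi₁ ▸ h') (fun hh => h1 (hu hh))
    · exact absurd (hi₂ ▸ h') (fun hh => h2 (hu hh))
  have hAu : ∀ i, u i ≠ A₁ ∧ u i ≠ A₂ := by
    intro i
    rcases hU i with ⟨-, hne₁, hne₂⟩ | h' | h'
    · exact ⟨hne₁, hne₂⟩
    · rw [h']; constructor <;> (intro h''; rw [h''] at hC₁; omega)
    · rw [h']; constructor <;> (intro h''; rw [h''] at hC₂; omega)
  have hbinj : Function.Injective b := by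
    refine update_injective _ (update_injective u hu i₁ A₁ fun i => (hAu i).1) i₂ A₂ fun i' => ?_
    by_cases h' : i' = i₁
    · rw [h', Function.update_self]; exact hA
    · rw [Function.update_of_ne h']; exact (hAu i').2
  have hC₁b : ∀ i, b i ≠ C₁ := by
    intro i h'
    by_cases h1 : i = i₁
    · rw [h1, hb₁] at h'; rw [h'] at hA₁; omega
    by_cases h2 : i = i₂
    · rw [h2, hb₂] at h'; rw [h'] at hA₂; omega
    · rw [hb i h1 h2, ← hi₁] at h'; exact h1 (hu h')
  have hC₂b : ∀ i, b i ≠ C₂ := by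
    intro i h'
    by_cases h1 : i = i₁
    · rw [h1, hb₁] at h'; rw [h'] at hA₁; omega
    by_cases h2 : i = i₂
    · rw [h2, hb₂] at h'; rw [h'] at hA₂; omega
    · rw [hb i h1 h2, ← hi₂] at h'; exact h2 (hu h')
  have hF1 : (mat (tab2 N₁ N₂ ![1, 0]) (Function.update b i₁ C₁) cols).det ≠ 0 := by
    rw [hT10]
    refine swapTable'_det_ne_zero hk₁ A₁ C₁ e₁ m1 m2 m3 m4 _ cols (update_injective b hbinj i₁ C₁ hC₁b) ?_
      (by rw [hkj₁]; exact hcols)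
    intro i
    by_cases hi : i = i₁
    · right; rw [hi, Function.update_self]
    · left
      rw [Function.update_of_ne hi]
      by_cases h2 : i = i₂
      · rw [h2, hb₂]; exact ⟨by omega, Ne.symm hA⟩
      · have := hbval i hi h2; exact ⟨by rw [hkj₁]; exact this.1, this.2.1⟩
  have hF2 : (mat (tab2 N₁ N₂ ![0, 1]) (Function.update b i₂ C₂) cols).det ≠ 0 := by
    rw [hT01]
    refine swapTable'_det_ne_zero hk₂ A₂ C₂ e₂ n1 n2 n3 n4 _ cols (update_injective b hbinj i₂ C₂ hC₂b) ?_
      (by rw [hkj₂]; exact hcols)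
    intro i
    by_cases hi : i = i₂
    · right; rw [hi, Function.update_self]
    · left
      rw [Function.update_of_ne hi]
      by_cases h1 : i = i₁
      · rw [h1, hb₁]; exact ⟨by omega, hA⟩
      · have := hbval i h1 hi; exact ⟨by rw [hkj₂]; exact this.1, this.2.2⟩
  -- THEOREM 2U kills the cross minor `D_{B − A₂ + C₁}` for every parameter
  have hZ : ∀ ε, (mat (tab2 N₁ N₂ ε) (Function.update b i₂ C₁) cols).det = 0 := by
    intro ε
    have hyy' : y ≠ y' := fun h' => hy₄ (h' ▸ hy'₁)
    -- unit columns
    have hcy1 : ∀ a, a ≠ y → swapTable' e₁ a y = 0 := fun a ha =>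
      swapTable'_col_unit A₁ C₁ e₁ m1 m2 (fun h' => hy₂ (Finset.mem_sdiff.1 h').1) (fun _ => htop₁.symm) ha
    have hcy2 : ∀ a, a ≠ y → swapTable' e₂ a y = 0 := fun a ha =>
      swapTable'_col_unit A₂ C₂ e₂ n1 n2 (fun h' => hy₃ (Finset.mem_sdiff.1 h').1)
        (fun h' => absurd (Finset.mem_sdiff.1 h').1 hy₄) ha
    have hcy'1 : ∀ a, a ≠ y' → swapTable' e₁ a y' = 0 := fun a ha =>
      swapTable'_col_unit A₁ C₁ e₁ m1 m2 (fun h' => (Finset.mem_sdiff.1 h').2 hy'₄)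
        (fun h' => absurd hy'₃ (Finset.mem_sdiff.1 h').2) ha
    have hcy'2 : ∀ a, a ≠ y' → swapTable' e₂ a y' = 0 := fun a ha =>
      swapTable'_col_unit A₂ C₂ e₂ n1 n2 (fun h' => hy'₂ (Finset.mem_sdiff.1 h').1) (fun _ => htop₂.symm) ha
    have hcol₁ : ∀ a, a ≠ y → tab2 N₁ N₂ ε a y = 0 := by
      intro a ha; simp only [tab2, N₁, N₂, hcy1 a ha, hcy2 a ha, if_neg (Ne.symm ha)]; ring
    have hcol₂ : ∀ a, a ≠ y' → tab2 N₁ N₂ ε a y' = 0 := by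
      intro a ha; simp only [tab2, N₁, N₂, hcy'1 a ha, hcy'2 a ha, if_neg (Ne.symm ha)]; ring
    have hdiag : ∀ a, tab2 N₁ N₂ ε a a = 1 := by
      intro a; simp [tab2, N₁, N₂, swapTable'_self]
    -- the rows of `y` and `y'`: sources only `p` and `p'`
    have hrow1 : ∀ d, d ≠ y → d ≠ p → swapTable' e₁ y d = 0 := by
      intro d hdy hdp; by_contra h'
      rw [← htop₁] at h' hdy
      have := swapTable'_top_row hk₁ e₁ h' hdy
      rw [hpred₁] at this; exact hdp this
    have hrow1' : ∀ d, d ≠ y → swapTable' e₂ y d = 0 := by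
      intro d hdy; by_contra h'
      have := swapTable'_offdiag A₂ C₂ e₂ n1 h' hdy
      exact hy₄ (Finset.mem_sdiff.1 this).1
    have hrow2 : ∀ d, d ≠ y' → d ≠ p' → swapTable' e₂ y' d = 0 := by
      intro d hdy hdp; by_contra h'
      rw [← htop₂] at h' hdy
      have := swapTable'_top_row hk₂ e₂ h' hdy
      rw [hpred₂] at this; exact hdp this
    have hrow2' : ∀ d, d ≠ y' → swapTable' e₁ y' d = 0 := by
      intro d hdy; by_contra h'
      have := swapTable'_offdiag A₁ C₁ e₁ m1 h' hdy
      exact (Finset.mem_sdiff.1 this).2 hy'₃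
    have hdisj : ∀ d, d ≠ y → d ≠ y' → tab2 N₁ N₂ ε y d * tab2 N₁ N₂ ε y' d = 0 := by
      intro d hdy hdy'
      by_cases hdp : d = p
      · have hdp' : d ≠ p' := fun h' => hpp (hdp.symm.trans h')
        have : tab2 N₁ N₂ ε y' d = 0 := by
          simp only [tab2, N₁, N₂, hrow2 d hdy' hdp', hrow2' d hdy', if_neg hdy']; ring
        rw [this, mul_zero]
      · have : tab2 N₁ N₂ ε y d = 0 := by
          simp only [tab2, N₁, N₂, hrow1 d hdy hdp, hrow1' d hdy, if_neg hdy]; ring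
        rw [this, zero_mul]
    refine det_eq_zero_of_two_unfed (tab2 N₁ N₂ ε) hyy' hcol₁ hcol₂ (hdiag y) (hdiag y') hdisj t
      (Function.update b i₂ C₁) cols hcolcard i₂ (by rw [Function.update_self, hC₁])
      (by rw [Function.update_self]; exact hy₁) (by rw [Function.update_self]; exact hy'₄)
      A₂ hA₂ hy₃ hy'₂ ?_ ?_ ?_
    · intro i
      by_cases hi : i = i₂
      · rw [hi, Function.update_self]; intro h'; rw [h'] at hC₁; omega
      · rw [Function.update_of_ne hi]
        by_cases h1 : i = i₁
        · rw [h1, hb₁]; exact hA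
        · exact (hbval i h1 hi).2.2
    · intro i hi
      rw [Function.update_of_ne hi]
      by_cases h1 : i = i₁
      · rw [h1, hb₁]; omega
      · exact (hbval i h1 hi).1
    · intro R hR hR₂
      by_cases hR₁ : R = A₁
      · exact ⟨i₁, hne, by rw [Function.update_of_ne hne, hb₁, hR₁]⟩
      · obtain ⟨i, hi1, hi2, hi⟩ := hball R hR hR₁ hR₂
        exact ⟨i, hi2, by rw [Function.update_of_ne hi2, hb i hi1 hi2, hi]⟩
  obtain ⟨tx, htx⟩ := exists_table_of_cross_zero N₁ N₂ b cols hne C₁ C₂ hF1 hF2 (Or.inr hZ)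
  exact ⟨tx, by rw [hub] at htx; exact htx⟩

end SecondShell

end

end Summit.ValiantsHypothesis.ValiantsHypothesis.Theorems.BarrierLever.HiddenStates
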